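import Summits.AtomisticToContinuum.BoseEinsteinCondensation.Theorems.BECInsertionCorrectorStaticResponseBoundTruncationCompactness
import Summits.AtomisticToContinuum.BoseEinsteinCondensation.Theorems.BECGroundStateSOSPeriodicIRBoundWFPotCross
import Summits.AtomisticToContinuum.BoseEinsteinCondensation.Theorems.BECConjugateDominationIMUChainGlueEnergy
import Literature.MathematicalPhysics.QuantumManyBody.PeriodicMaxFormGroundStates
import Literature.MathematicalPhysics.QuantumManyBody.PeriodicMaxFormApproximation
import Literature.MathematicalPhysics.QuantumManyBody.PeriodicFeynmanKacEnergyLower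
import HarnessLib

/-!
# Perron–Frobenius uniqueness of the periodic Bose ground state, part 1: positivity and signs

Helper file (part 1 of 2) for the stub `stub_minimiserUniqueOfPositive` (S-C2) of line
`linear-ph-floor-wagner` of the crux `BECGroundStateSOS.PeriodicIRBound` (item stmt-AtomisticToContinuum-3972).
Classical source: [ReedSimonIV1978, §XIII.12, Thms XIII.43–44].

We work in the ground-state class `maxFormGroundStates v N L` of the MAXIMAL form on `L²((ℝ/ℤ)^{3N})` (Haar
probability measure) of the tree (`PeriodicMaxFormGroundStates.lean`: a `ℂ`-subspace of Bose-symmetric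
classes, stable under conjugation, modulus, real and imaginary parts). Taking the positivity statement KEY
(stub S-B of the line: nonnegative `L²(cell)`-normalised periodic functions that are `L²`-limits of real
periodic `C¹` functions of energy `→ E₀` are a.e. positive on the cell) as a HYPOTHESIS, we prove:

* `periodicGroundStateEnergy_integrable_ne_top` — `E₀ < ∞` when `∫ v(|x|)dx < ∞` (constant trial state);
* `ae_ne_zero_of_nonneg_groundState` — a nonnegative nonzero ground state is a.e. nonzero: the cell function
  `L^{-3N/2} h ∘ toUnitTorusN L` satisfies the hypotheses of KEY, its approximants being the real parts of the
  `C¹` Bose trial states of `exists_trialState_maxForm_approx` (transport lemmas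
  `ae_restrict_cellN_comp_toUnitTorusN`, `ae_of_ae_restrict_cellN_comp_toUnitTorusN` between the Haar torus and
  `L^{-3N} dX|_{cell}`);
* `ae_sign_of_real_groundState` — a nonzero REAL ground state is either a.e. `> 0` or a.e. `< 0`
  (`|g| - g` is a nonnegative ground state); registered as `stub_pfRealMinimiserSign`.
-/

noncomputable section

namespace Summit.AtomisticToContinuum.BoseEinsteinCondensation.Cruxes.PeriodicIRBound.LinearPhFloorWagner

open MeasureTheory Filter UnitAddTorus
open scoped ENNReal NNReal Topology InnerProductSpace ComplexConjugate
open Literature.MathematicalPhysics.QuantumManyBody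
open Literature.MathematicalPhysics.QuantumManyBody.BoseGas

-- The measure on `ℝ/ℤ` is the Haar PROBABILITY measure, as in `PeriodicFormDomain.lean`.
attribute [local instance] Literature.MathematicalPhysics.QuantumManyBody.BoseGas.formDomain_measureSpace
  Literature.MathematicalPhysics.QuantumManyBody.BoseGas.formDomain_isProbabilityMeasure
  Literature.MathematicalPhysics.QuantumManyBody.BoseGas.formDomain_isProbabilityMeasure_pi

variable {N : ℕ} {L : ℝ}

/-- Local notation for the Hilbert space `L²((ℝ/ℤ)^{3N})`, as in `PeriodicFormDomain.lean`. -/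
local notation "L2T " N':max => Lp ℂ 2 (volume : Measure (UnitAddTorus (Fin N' × Fin 3)))

set_option quotPrecheck false in
/-- Local notation: the positivity statement KEY (stub S-B of the line), taken as a hypothesis. -/
local notation "KEYPROP" => ∀ {N : ℕ}, 1 ≤ N → ∀ {L : ℝ}, 0 < L → ∀ {v : ℝ → ℝ≥0∞}, IsRepulsiveFiniteRange v →
    (∫⁻ x : Space, v ‖x‖) ≠ ⊤ →
      ∀ f : Config N → ℝ, Measurable f → (∀ X, 0 ≤ f X) →
        (∀ (X : Config N) (i : Fin N) (k : Fin 3), f (X + Pi.single i (EuclideanSpace.single k L)) = f X) →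
        (∫⁻ X in cellN N L, ENNReal.ofReal (f X ^ 2)) = 1 →
        (∀ ε : ℝ, 0 < ε → ∃ φ : Config N → ℝ, ContDiff ℝ 1 φ ∧
          (∀ (X : Config N) (i : Fin N) (k : Fin 3), φ (X + Pi.single i (EuclideanSpace.single k L)) = φ X) ∧
          (∫⁻ X in cellN N L, ENNReal.ofReal ((φ X - f X) ^ 2)) ≤ ENNReal.ofReal ε ∧
          (∫⁻ X in cellN N L, realKinetic φ X) +
              (∫⁻ X in cellN N L, ENNReal.ofReal (φ X ^ 2) * periodicInteraction v L X) ≤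
            periodicGroundStateEnergy v N L + ENNReal.ofReal ε) →
        ∀ᵐ X ∂(volume.restrict (cellN N L)), 0 < f X

/-! ### Finiteness of the ground-state energy -/

/-- **`E₀^per(N, L) < ∞` for an integrable profile** (`L > 0`): the constant state has energy
`L^{-3N} ∫_{[0,L)^{3N}} W < ∞`. [folklore] -/
theorem periodicGroundStateEnergy_integrable_ne_top (hL : 0 < L) {v : ℝ → ℝ≥0∞} (hv : Measurable v)
    (hint : (∫⁻ x : Space, v ‖x‖) ≠ ⊤) (N : ℕ) : periodicGroundStateEnergy v N L ≠ ⊤ := by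
  have hW := WF.lintegral_cellN_periodicInteraction_ne_top hL hv hint N
  set c : ℂ := ((Real.sqrt ((L ^ 3) ^ N))⁻¹ : ℂ) with hc
  let Ψ : PeriodicTrialState N L :=
    ⟨fun _ => c, contDiff_const, fun _ _ _ => rfl, fun _ _ => rfl,
      Theorems.IMUChainGlue.setLIntegral_nnnorm_constN_sq hL _⟩
  refine ne_top_of_le_ne_top ?_ (periodicGroundStateEnergy_le v Ψ)
  have hkin : ∀ X : Config N, kineticDensity (fun _ : Config N => c) X = 0 := fun X => by
    simp [kineticDensity]
  have hE : periodicEnergy v Ψ = (∫⁻ X in cellN N L, periodicInteraction v L X) * (‖c‖₊ : ℝ≥0∞) ^ 2 := by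
    rw [periodicEnergy, ← lintegral_mul_const' _ _ (ENNReal.pow_ne_top ENNReal.coe_ne_top)]
    refine lintegral_congr fun X => ?_
    show kineticDensity (fun _ : Config N => c) X + periodicInteraction v L X * (‖c‖₊ : ℝ≥0∞) ^ 2 = _
    rw [hkin, zero_add]
  rw [hE]
  exact ENNReal.mul_ne_top hW (ENNReal.pow_ne_top ENNReal.coe_ne_top)

/-! ### Transport between the Haar torus and the cell -/

section Transport

/-- `toUnitTorusN L` is `Lℤ³`-periodic in every particle. [folklore] -/
theorem toUnitTorusN_add_single (hL : L ≠ 0) (X : Config N) (i : Fin N) (k : Fin 3) :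
    toUnitTorusN L (X + Pi.single i (EuclideanSpace.single k L)) = toUnitTorusN L X := by
  funext p
  rw [toUnitTorusN_apply, toUnitTorusN_apply, Pi.add_apply, PiLp.add_apply, add_div]
  push_cast
  rcases eq_or_ne p.1 i with h1 | h1
  · rw [h1, Pi.single_eq_same, PiLp.single_apply]
    split_ifs with h2
    · rw [div_self hL, AddCircle.coe_add]
      have : ((1 : ℝ) : UnitAddCircle) = 0 := by
        rw [AddCircle.coe_eq_zero_iff]; exact ⟨1, by simp⟩
      rw [this, add_zero]
    · simp
  · rw [Pi.single_eq_of_ne h1]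
    simp

/-- The Haar measure of the torus is the image under `toUnitTorusN L` of `L^{-3N} dX|_{[0,L)^{3N}}`. [folklore] -/
theorem map_toUnitTorusN_smul_restrict (hL : 0 < L) :
    Measure.map (toUnitTorusN (N := N) L) (((ENNReal.ofReal L ^ 3)⁻¹) ^ N • volume.restrict (cellN N L)) =
      (volume : Measure (UnitAddTorus (Fin N × Fin 3))) := by
  rw [← map_fromUnitTorusN hL, Measure.map_map (measurable_toUnitTorusN L) (measurable_fromUnitTorusN L)]
  have hid : (toUnitTorusN (N := N) L) ∘ (fromUnitTorusN L) = id := funext (toUnitTorusN_fromUnitTorusN hL.ne')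
  rw [hid, Measure.map_id]

/-- An a.e. property on the torus holds a.e. on the cell after composition with `toUnitTorusN L`. [folklore] -/
theorem ae_restrict_cellN_comp_toUnitTorusN (hL : 0 < L) {p : UnitAddTorus (Fin N × Fin 3) → Prop}
    (h : ∀ᵐ t ∂(volume : Measure (UnitAddTorus (Fin N × Fin 3))), p t) :
    ∀ᵐ X ∂(volume.restrict (cellN N L)), p (toUnitTorusN L X) := by
  rw [← map_toUnitTorusN_smul_restrict (N := N) hL] at h
  have h' := ae_of_ae_map (measurable_toUnitTorusN L).aemeasurable h
  have hc : ((ENNReal.ofReal L ^ 3)⁻¹) ^ N ≠ 0 :=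
    pow_ne_zero _ (ENNReal.inv_ne_zero.2 (ENNReal.pow_ne_top ENNReal.ofReal_ne_top))
  rwa [Measure.ae_ennreal_smul_measure_iff hc] at h'

/-- Conversely, a property holding a.e. on the cell after composition with `toUnitTorusN L` holds a.e. on
the torus. [folklore] -/
theorem ae_of_ae_restrict_cellN_comp_toUnitTorusN (hL : 0 < L) {p : UnitAddTorus (Fin N × Fin 3) → Prop}
    (h : ∀ᵐ X ∂(volume.restrict (cellN N L)), p (toUnitTorusN L X)) :
    ∀ᵐ t ∂(volume : Measure (UnitAddTorus (Fin N × Fin 3))), p t := by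
  have h1 : ∀ᵐ X ∂(Measure.map (fromUnitTorusN (N := N) L) volume), p (toUnitTorusN L X) := by
    rw [map_fromUnitTorusN hL]
    exact Measure.ae_smul_measure h _
  filter_upwards [ae_of_ae_map (measurable_fromUnitTorusN L).aemeasurable h1] with t ht
  rwa [toUnitTorusN_fromUnitTorusN hL.ne'] at ht

/-- `∫ G(toUnitTorusN L ·)` over the torus-lifted cell: `∫⁻ t, G t = L^{-3N} ∫⁻_{cell} G (toUnitTorusN L X)`.
[folklore] -/
theorem lintegral_eq_lintegral_cellN_comp_toUnitTorusN (hL : 0 < L) {G : UnitAddTorus (Fin N × Fin 3) → ℝ≥0∞}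
    (hG : Measurable G) :
    ∫⁻ t, G t = ((ENNReal.ofReal L ^ 3)⁻¹) ^ N * ∫⁻ X in cellN N L, G (toUnitTorusN L X) := by
  rw [← lintegral_fromUnitTorusN hL (G := fun X => G (toUnitTorusN L X)) (hG.comp (measurable_toUnitTorusN L))]
  refine lintegral_congr fun t => ?_
  rw [toUnitTorusN_fromUnitTorusN hL.ne']

end Transport

/-! ### Positivity of nonnegative ground states (from KEY) -/

section Positivity

open Summit.AtomisticToContinuum.BoseEinsteinCondensation.Cruxes.StaticResponseBound.UvThomsonForceWave

/-- `ofReal ((cellScale N L)⁻¹ ^ 2) = (L^{3N})⁻¹` in `ℝ≥0∞`. [folklore] -/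
theorem ofReal_inv_cellScale_sq (hL : 0 < L) :
    ENNReal.ofReal ((cellScale N L)⁻¹ ^ 2) = ((ENNReal.ofReal L ^ 3)⁻¹) ^ N := by
  rw [inv_pow, cellScale_sq hL.le, ← inv_pow, ofReal_inv_pow_three_pow hL N]

/-- **A nonnegative normalised ground state is a.e. nonzero** (KEY transported from the cell to the torus):
for a unit `h ≥ 0` in the ground-state class, the cell function `L^{-3N/2} h ∘ toUnitTorusN L` satisfies the
hypotheses of KEY — its approximants are the real parts of the `C¹` Bose trial states of
`exists_trialState_maxForm_approx`. [cite: ReedSimonIV1978, §XIII.12 Thm. XIII.44] -/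
theorem ae_ne_zero_of_nonneg_groundState (KEY : KEYPROP) (hN : 1 ≤ N) (hL : 0 < L) {v : ℝ → ℝ≥0∞}
    (hv : IsRepulsiveFiniteRange v) (hint : (∫⁻ x : Space, v ‖x‖) ≠ ⊤) (h : L2T N) (h1 : ‖h‖ = 1)
    (hM : h ∈ maxFormGroundStates v N L)
    (hnn : ∀ᵐ t ∂(volume : Measure (UnitAddTorus (Fin N × Fin 3))), (h : UnitAddTorus (Fin N × Fin 3) → ℂ) t =
      ((‖(h : UnitAddTorus (Fin N × Fin 3) → ℂ) t‖ : ℝ) : ℂ)) :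
    ∀ᵐ t ∂(volume : Measure (UnitAddTorus (Fin N × Fin 3))), (h : UnitAddTorus (Fin N × Fin 3) → ℂ) t ≠ 0 := by
  have hWint := WF.lintegral_cellN_periodicInteraction_ne_top hL hv.1 hint N
  have hE := periodicGroundStateEnergy_integrable_ne_top hL hv.1 hint N
  have hQ : maxForm v L h ≤ periodicGroundStateEnergy v N L := by
    have h' := hM.2
    rwa [h1, one_pow, ENNReal.ofReal_one, mul_one] at h'
  set E₀ := periodicGroundStateEnergy v N L with hE₀
  set cs : ℝ := cellScale N L with hcs
  have hcs0 : 0 < cs := Real.sqrt_pos.2 (by positivity)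
  set hh : UnitAddTorus (Fin N × Fin 3) → ℂ := (h : UnitAddTorus (Fin N × Fin 3) → ℂ) with hhh
  have hhm : Measurable hh := (Lp.stronglyMeasurable h).measurable
  -- the cell function
  set f : Config N → ℝ := fun X => cs⁻¹ * ‖hh (toUnitTorusN L X)‖ with hfdef
  have hfm : Measurable f := measurable_const.mul (hhm.comp (measurable_toUnitTorusN L)).norm
  have hf0 : ∀ X, 0 ≤ f X := fun X => by positivity
  have hfper : ∀ (X : Config N) (i : Fin N) (k : Fin 3), f (X + Pi.single i (EuclideanSpace.single k L)) = f X := by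
    intro X i k
    simp only [hfdef, toUnitTorusN_add_single hL.ne']
  have hfsq : ∀ X, ENNReal.ofReal (f X ^ 2) = ((ENNReal.ofReal L ^ 3)⁻¹) ^ N * (‖hh (toUnitTorusN L X)‖₊ : ℝ≥0∞) ^ 2 :=
    fun X => by
      rw [hfdef, mul_pow, ENNReal.ofReal_mul (sq_nonneg _), ofReal_inv_cellScale_sq hL, coe_nnnorm_sq_eq_ofReal]
  -- normalisation
  have hnorm1 : ∫⁻ t, ((‖hh t‖₊ : ℝ≥0∞)) ^ 2 = 1 := by
    rw [← ENNReal.ofReal_toReal (norm_Lp_two_sq_eq_toReal h).2, ← (norm_Lp_two_sq_eq_toReal h).1, h1, one_pow,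
      ENNReal.ofReal_one]
  have hfnorm : (∫⁻ X in cellN N L, ENNReal.ofReal (f X ^ 2)) = 1 := by
    simp only [hfsq]
    rw [lintegral_const_mul' _ _ (ENNReal.pow_ne_top (ENNReal.inv_ne_top.2 (pow_ne_zero _ (ENNReal.ofReal_pos.2 hL).ne'))),
      ← lintegral_eq_lintegral_cellN_comp_toUnitTorusN hL (hhm.nnnorm.coe_nnreal_ennreal.pow_const 2), hnorm1]
  -- `h ∘ toUnitTorusN` is a.e. nonnegative real on the cell
  have hnnc : ∀ᵐ X ∂(volume.restrict (cellN N L)), hh (toUnitTorusN L X) = ((‖hh (toUnitTorusN L X)‖ : ℝ) : ℂ) :=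
    ae_restrict_cellN_comp_toUnitTorusN hL hnn
  -- the approximation property
  have hfin : maxForm v L h ≠ ⊤ := ne_top_of_le_ne_top hE hQ
  have happrox : ∀ ε : ℝ, 0 < ε → ∃ φ : Config N → ℝ, ContDiff ℝ 1 φ ∧
      (∀ (X : Config N) (i : Fin N) (k : Fin 3), φ (X + Pi.single i (EuclideanSpace.single k L)) = φ X) ∧
      (∫⁻ X in cellN N L, ENNReal.ofReal ((φ X - f X) ^ 2)) ≤ ENNReal.ofReal ε ∧
      (∫⁻ X in cellN N L, realKinetic φ X) +
          (∫⁻ X in cellN N L, ENNReal.ofReal (φ X ^ 2) * periodicInteraction v L X) ≤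
        periodicGroundStateEnergy v N L + ENNReal.ofReal ε := by
    intro ε hε
    set ε' : ℝ := min ε 1 with hε'
    have hε'0 : 0 < ε' := lt_min hε one_pos
    have hε'ε : ε' ≤ ε := min_le_left _ _
    have hε'sq : ε' ^ 2 ≤ ε := by nlinarith [min_le_right ε 1]
    obtain ⟨Φ, hΦE, hΦd⟩ := exists_trialState_maxForm_approx hL measurable_zeroProfile
      (lintegral_periodicInteraction_zero_ne_top N L) hv.1 hWint h h1 hM.1 hfin hε'0
    refine ⟨fun X => (Φ.ψ X).re, Complex.reCLM.contDiff.comp Φ.contDiff, fun X i k => ?_, ?_, ?_⟩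
    · show (Φ.ψ (X + _)).re = (Φ.ψ X).re
      rw [Φ.periodic]
    · -- the `L²` distance on the cell
      set D : L2T N := formEmbed hL measurable_zeroProfile (lintegral_periodicInteraction_zero_ne_top N L)
        ⟨graphEmbed hL measurable_zeroProfile (lintegral_periodicInteraction_zero_ne_top N L) ⟨Φ.ψ, Φ.mem_periodicCore⟩,
          graphEmbed_mem_formDomain hL measurable_zeroProfile (lintegral_periodicInteraction_zero_ne_top N L) _⟩ - h
        with hD
      have hDint : ∫⁻ t, ((‖(D : UnitAddTorus (Fin N × Fin 3) → ℂ) t‖₊ : ℝ≥0∞)) ^ 2 ≤ ENNReal.ofReal ε := by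
        rw [← ENNReal.ofReal_toReal (norm_Lp_two_sq_eq_toReal D).2, ← (norm_Lp_two_sq_eq_toReal D).1]
        refine ENNReal.ofReal_le_ofReal (le_trans ?_ hε'sq)
        exact pow_le_pow_left₀ (norm_nonneg _) hΦd 2
      set G : Config N → ℝ≥0∞ := fun X => ((‖(cs : ℂ) * Φ.ψ X - hh (toUnitTorusN L X)‖₊ : ℝ≥0∞)) ^ 2 with hGdef
      have hGm : Measurable G :=
        ((measurable_const.mul Φ.contDiff.continuous.measurable).sub
          (hhm.comp (measurable_toUnitTorusN L))).nnnorm.coe_nnreal_ennreal.pow_const 2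
      have hDG : ∫⁻ t, ((‖(D : UnitAddTorus (Fin N × Fin 3) → ℂ) t‖₊ : ℝ≥0∞)) ^ 2 =
          ((ENNReal.ofReal L ^ 3)⁻¹) ^ N * ∫⁻ X in cellN N L, G X := by
        rw [← lintegral_fromUnitTorusN hL hGm]
        refine lintegral_congr_ae ?_
        filter_upwards [Lp.coeFn_sub (formEmbed hL measurable_zeroProfile (lintegral_periodicInteraction_zero_ne_top N L)
          ⟨graphEmbed hL measurable_zeroProfile (lintegral_periodicInteraction_zero_ne_top N L) ⟨Φ.ψ, Φ.mem_periodicCore⟩,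
            graphEmbed_mem_formDomain hL measurable_zeroProfile (lintegral_periodicInteraction_zero_ne_top N L) _⟩) h,
          StaticResponseBound.UvThomsonForceWave.coeFn_formEmbed_trialState hL Φ] with t ht1 ht2
        rw [hD, ht1, Pi.sub_apply, ht2, hGdef]
        simp only [hhh]
        rw [toUnitTorusN_fromUnitTorusN hL.ne']
      have hcellG : ((ENNReal.ofReal L ^ 3)⁻¹) ^ N * ∫⁻ X in cellN N L, G X ≤ ENNReal.ofReal ε := hDG ▸ hDint
      refine le_trans ?_ hcellG
      rw [← lintegral_const_mul' _ _ (ENNReal.pow_ne_top (ENNReal.inv_ne_top.2 (pow_ne_zero _ (ENNReal.ofReal_pos.2 hL).ne')))]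
      refine lintegral_mono_ae (hnnc.mono fun X hX => ?_)
      have hre : (Φ.ψ X).re - f X = ((Φ.ψ X) - (cs : ℂ)⁻¹ * hh (toUnitTorusN L X)).re := by
        rw [Complex.sub_re, hX, ← Complex.ofReal_inv, ← Complex.ofReal_mul, Complex.ofReal_re]
      have hfac : (Φ.ψ X) - (cs : ℂ)⁻¹ * hh (toUnitTorusN L X) = (cs : ℂ)⁻¹ * ((cs : ℂ) * Φ.ψ X - hh (toUnitTorusN L X)) := by
        have hcsC : (cs : ℂ) ≠ 0 := Complex.ofReal_ne_zero.2 hcs0.ne'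
        field_simp
      calc ENNReal.ofReal (((Φ.ψ X).re - f X) ^ 2)
          ≤ ENNReal.ofReal (‖(Φ.ψ X) - (cs : ℂ)⁻¹ * hh (toUnitTorusN L X)‖ ^ 2) := by
            rw [hre]
            exact ENNReal.ofReal_le_ofReal (sq_le_sq' (abs_le.1 (Complex.abs_re_le_norm _)).1 (Complex.re_le_norm _))
        _ = ((ENNReal.ofReal L ^ 3)⁻¹) ^ N * G X := by
            rw [hfac, norm_mul, mul_pow, ENNReal.ofReal_mul (sq_nonneg _), norm_inv, Complex.norm_real,
              Real.norm_of_nonneg hcs0.le, ofReal_inv_cellScale_sq hL]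
            simp only [hGdef, coe_nnnorm_sq_eq_ofReal]
    · -- the energy of the real part
      have hsplit := periodicEnergy_eq_re_add_im hv.1 Φ
      calc (∫⁻ X in cellN N L, realKinetic (fun Y => (Φ.ψ Y).re) X) +
            (∫⁻ X in cellN N L, ENNReal.ofReal ((Φ.ψ X).re ^ 2) * periodicInteraction v L X)
          ≤ periodicEnergy v Φ := by rw [hsplit]; exact le_self_add
        _ ≤ maxForm v L h + ENNReal.ofReal ε' := hΦE
        _ ≤ E₀ + ENNReal.ofReal ε := add_le_add hQ (ENNReal.ofReal_le_ofReal hε'ε)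
  -- KEY
  have hpos := KEY hN hL hv hint f hfm hf0 hfper hfnorm happrox
  refine ae_of_ae_restrict_cellN_comp_toUnitTorusN hL (p := fun t => hh t ≠ 0) ?_
  filter_upwards [hpos] with X hX
  intro h0
  rw [hfdef] at hX
  simp only [h0, norm_zero, mul_zero, lt_self_iff_false] at hX

end Positivity

/-! ### Strict sign of real ground states -/

section Sign

/-- **A nonnegative ground state is a.e. nonzero** (not necessarily normalised): rescale and apply
`ae_ne_zero_of_nonneg_groundState`. [cite: ReedSimonIV1978, §XIII.12 Thm. XIII.44] -/
theorem ae_ne_zero_of_nonneg_groundState' (KEY : KEYPROP) (hN : 1 ≤ N) (hL : 0 < L) {v : ℝ → ℝ≥0∞}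
    (hv : IsRepulsiveFiniteRange v) (hint : (∫⁻ x : Space, v ‖x‖) ≠ ⊤) (h : L2T N) (h0 : h ≠ 0)
    (hM : h ∈ maxFormGroundStates v N L)
    (hnn : ∀ᵐ t ∂(volume : Measure (UnitAddTorus (Fin N × Fin 3))), (h : UnitAddTorus (Fin N × Fin 3) → ℂ) t =
      ((‖(h : UnitAddTorus (Fin N × Fin 3) → ℂ) t‖ : ℝ) : ℂ)) :
    ∀ᵐ t ∂(volume : Measure (UnitAddTorus (Fin N × Fin 3))), (h : UnitAddTorus (Fin N × Fin 3) → ℂ) t ≠ 0 := by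
  set c : ℝ := ‖h‖⁻¹ with hc
  have hh0 : 0 < ‖h‖ := norm_pos_iff.2 h0
  have hc0 : 0 < c := inv_pos.2 hh0
  set g : L2T N := (c : ℂ) • h with hg
  have hg1 : ‖g‖ = 1 := by
    rw [hg, norm_smul, Complex.norm_real, Real.norm_of_nonneg hc0.le, hc, inv_mul_cancel₀ hh0.ne']
  have hgnn : ∀ᵐ t ∂(volume : Measure (UnitAddTorus (Fin N × Fin 3))), (g : UnitAddTorus (Fin N × Fin 3) → ℂ) t =
      ((‖(g : UnitAddTorus (Fin N × Fin 3) → ℂ) t‖ : ℝ) : ℂ) := by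
    filter_upwards [Lp.coeFn_smul (c : ℂ) h, hnn] with t h1 h2
    rw [h1, Pi.smul_apply, smul_eq_mul, h2, norm_mul, Complex.norm_real, Complex.norm_real,
      Real.norm_of_nonneg hc0.le, norm_norm, Complex.ofReal_mul]
  filter_upwards [ae_ne_zero_of_nonneg_groundState KEY hN hL hv hint g hg1 (smul_mem_maxFormGroundStates _ hM) hgnn,
    Lp.coeFn_smul (c : ℂ) h] with t h1 h2
  rw [h2, Pi.smul_apply, smul_eq_mul] at h1
  exact right_ne_zero_of_mul h1

/-- **Real ground states have a strict sign**: a nonzero real `g` in the ground-state class is either a.e.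
`> 0` or a.e. `< 0` (`|g| - g` is a nonnegative ground state, hence either `0` or a.e. nonzero).
[cite: ReedSimonIV1978, §XIII.12 Thm. XIII.44] -/
theorem ae_sign_of_real_groundState (KEY : KEYPROP) (hN : 1 ≤ N) (hL : 0 < L) {v : ℝ → ℝ≥0∞}
    (hv : IsRepulsiveFiniteRange v) (hint : (∫⁻ x : Space, v ‖x‖) ≠ ⊤) (g : L2T N) (hg0 : g ≠ 0)
    (hM : g ∈ maxFormGroundStates v N L)
    (hreal : ∀ᵐ t ∂(volume : Measure (UnitAddTorus (Fin N × Fin 3))), (g : UnitAddTorus (Fin N × Fin 3) → ℂ) t =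
      ((((g : UnitAddTorus (Fin N × Fin 3) → ℂ) t).re : ℝ) : ℂ)) :
    (∀ᵐ t ∂(volume : Measure (UnitAddTorus (Fin N × Fin 3))), 0 < ((g : UnitAddTorus (Fin N × Fin 3) → ℂ) t).re) ∨
      (∀ᵐ t ∂(volume : Measure (UnitAddTorus (Fin N × Fin 3))), ((g : UnitAddTorus (Fin N × Fin 3) → ℂ) t).re < 0) := by
  have hWint := WF.lintegral_cellN_periodicInteraction_ne_top hL hv.1 hint N
  have hE := periodicGroundStateEnergy_integrable_ne_top hL hv.1 hint N
  have hA := absLp_mem_maxFormGroundStates hM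
  have hAae := coeFn_absLp g
  have hd := sub_mem_maxFormGroundStates hL hv.1 hWint hE hA hM
  have hdae : ∀ᵐ t ∂(volume : Measure (UnitAddTorus (Fin N × Fin 3))),
      ((absLp g - g : L2T N) : UnitAddTorus (Fin N × Fin 3) → ℂ) t =
      ((‖(g : UnitAddTorus (Fin N × Fin 3) → ℂ) t‖ - ((g : UnitAddTorus (Fin N × Fin 3) → ℂ) t).re : ℝ) : ℂ) := by
    filter_upwards [Lp.coeFn_sub (absLp g) g, hAae, hreal] with t h1 h2 h3
    rw [h1, Pi.sub_apply, h2, Complex.ofReal_sub, ← h3]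
  have hdnn : ∀ᵐ t ∂(volume : Measure (UnitAddTorus (Fin N × Fin 3))),
      ((absLp g - g : L2T N) : UnitAddTorus (Fin N × Fin 3) → ℂ) t =
      ((‖((absLp g - g : L2T N) : UnitAddTorus (Fin N × Fin 3) → ℂ) t‖ : ℝ) : ℂ) := by
    filter_upwards [hdae] with t ht
    rw [ht, Complex.norm_real, Real.norm_of_nonneg (sub_nonneg.2 (Complex.re_le_norm _))]
  by_cases hd0 : absLp g - g = 0
  · left
    have hAg : absLp g = g := sub_eq_zero.1 hd0
    rw [hAg] at hAae
    filter_upwards [ae_ne_zero_of_nonneg_groundState' KEY hN hL hv hint g hg0 hM hAae, hAae] with t h1 h2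
    have h3 : ((g : UnitAddTorus (Fin N × Fin 3) → ℂ) t).re = ‖(g : UnitAddTorus (Fin N × Fin 3) → ℂ) t‖ := by
      rw [h2, Complex.ofReal_re, Complex.norm_real, norm_norm]
    rw [h3]
    exact norm_pos_iff.2 h1
  · right
    filter_upwards [ae_ne_zero_of_nonneg_groundState' KEY hN hL hv hint (absLp g - g) hd0 hd hdnn, hdae, hreal]
      with t h1 h2 h3
    rw [h2] at h1
    have h4 : ‖(g : UnitAddTorus (Fin N × Fin 3) → ℂ) t‖ ≠ ((g : UnitAddTorus (Fin N × Fin 3) → ℂ) t).re := fun h =>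
      h1 (by rw [h, sub_self, Complex.ofReal_zero])
    have h5 : ‖(g : UnitAddTorus (Fin N × Fin 3) → ℂ) t‖ = |((g : UnitAddTorus (Fin N × Fin 3) → ℂ) t).re| := by
      rw [h3, Complex.norm_real, Complex.ofReal_re, Real.norm_eq_abs]
    rw [h5] at h4
    rcases lt_or_ge ((g : UnitAddTorus (Fin N × Fin 3) → ℂ) t).re 0 with hlt | hge
    · exact hlt
    · exact absurd (abs_of_nonneg hge) h4

end Sign

/-- The registered sub-goal `stub_pfRealMinimiserSign` of the crux ledger (S-C2 part 1): this file's headline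
lemma `ae_sign_of_real_groundState` — KEY ⇒ nonzero real Bose maximal-form ground states have a strict a.e.
sign. [cite: ReedSimonIV1978, §XIII.12 Thm. XIII.44] -/
theorem stub_pfRealMinimiserSign :
    (∀ {N : ℕ}, 1 ≤ N → ∀ {L : ℝ}, 0 < L → ∀ {v : ℝ → ℝ≥0∞}, IsRepulsiveFiniteRange v → (∫⁻ x : Space, v ‖x‖) ≠ ⊤ →
      ∀ f : Config N → ℝ, Measurable f → (∀ X, 0 ≤ f X) →
        (∀ (X : Config N) (i : Fin N) (k : Fin 3), f (X + Pi.single i (EuclideanSpace.single k L)) = f X) →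
        (∫⁻ X in cellN N L, ENNReal.ofReal (f X ^ 2)) = 1 →
        (∀ ε : ℝ, 0 < ε → ∃ φ : Config N → ℝ, ContDiff ℝ 1 φ ∧
          (∀ (X : Config N) (i : Fin N) (k : Fin 3), φ (X + Pi.single i (EuclideanSpace.single k L)) = φ X) ∧
          (∫⁻ X in cellN N L, ENNReal.ofReal ((φ X - f X) ^ 2)) ≤ ENNReal.ofReal ε ∧
          (∫⁻ X in cellN N L, realKinetic φ X) +
              (∫⁻ X in cellN N L, ENNReal.ofReal (φ X ^ 2) * periodicInteraction v L X) ≤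
            periodicGroundStateEnergy v N L + ENNReal.ofReal ε) →
        ∀ᵐ X ∂(volume.restrict (cellN N L)), 0 < f X) →
    ∀ {N : ℕ}, 1 ≤ N → ∀ {L : ℝ}, 0 < L → ∀ {v : ℝ → ℝ≥0∞}, IsRepulsiveFiniteRange v → (∫⁻ x : Space, v ‖x‖) ≠ ⊤ →
      ∀ g : Lp ℂ 2 (volume : Measure (UnitAddTorus (Fin N × Fin 3))), g ≠ 0 →
        (∀ (σ : Equiv.Perm (Fin N)) (n : Fin N × Fin 3 → ℤ),
          ⟪(mFourierLp 2 (fun p : Fin N × Fin 3 => n (σ p.1, p.2)) : Lp ℂ 2 (volume : Measure (UnitAddTorus (Fin N × Fin 3)))), g⟫_ℂ =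
            ⟪(mFourierLp 2 n : Lp ℂ 2 (volume : Measure (UnitAddTorus (Fin N × Fin 3)))), g⟫_ℂ) →
        (∑' n : Fin N × Fin 3 → ℤ, ENNReal.ofReal (∑ p, (2 * Real.pi * (n p : ℝ) / L) ^ 2) *
              (‖⟪(mFourierLp 2 n : Lp ℂ 2 (volume : Measure (UnitAddTorus (Fin N × Fin 3)))), g⟫_ℂ‖₊ : ℝ≥0∞) ^ 2 +
            ∫⁻ t, periodicInteraction v L (fromUnitTorusN L t) *
              (‖(g : UnitAddTorus (Fin N × Fin 3) → ℂ) t‖₊ : ℝ≥0∞) ^ 2) ≤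
          periodicGroundStateEnergy v N L * ENNReal.ofReal (‖g‖ ^ 2) →
        (∀ᵐ t ∂(volume : Measure (UnitAddTorus (Fin N × Fin 3))), (g : UnitAddTorus (Fin N × Fin 3) → ℂ) t =
          ((((g : UnitAddTorus (Fin N × Fin 3) → ℂ) t).re : ℝ) : ℂ)) →
        (∀ᵐ t ∂(volume : Measure (UnitAddTorus (Fin N × Fin 3))), 0 < ((g : UnitAddTorus (Fin N × Fin 3) → ℂ) t).re) ∨
          (∀ᵐ t ∂(volume : Measure (UnitAddTorus (Fin N × Fin 3))), ((g : UnitAddTorus (Fin N × Fin 3) → ℂ) t).re < 0) :=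
  fun KEY _ hN _ hL _ hv hint g hg0 hsymm hQ hreal =>
    ae_sign_of_real_groundState KEY hN hL hv hint g hg0 ⟨hsymm, hQ⟩ hreal

end Summit.AtomisticToContinuum.BoseEinsteinCondensation.Cruxes.PeriodicIRBound.LinearPhFloorWagner

end
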